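/- Width seat `ym-line-sfw-p2-w5` (prover-ym-line-sfw-p2-w5-g18-0), free hands for planner ym-idea-2's STUB-PLAN-E/F (LINE-17 on crux
`AllWindowsColdBox.BoxMidWindowsSU22` = stmt-QuantumFields-24003, stubs E `stub_tiltMoments` / F `stub_gaussSideTerms`): the cubic chaos of an
ARBITRARY SUB-FAMILY of plaquettes (one plaquette for F, all touching plaquettes for E). -/
import Summits.QuantumFields.YangMills.Theorems.AllWindowsColdBoxTiltCubicForm

/-!
# The cubic part of the tilt restricted to a sub-family of plaquettes, as a trace-free cubic form (STUB-PLAN-E/F, E(1) for sub-families)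

`AllWindowsColdBoxTiltCubicForm` treats the cubic part of the tilt summed over ALL plaquettes touching the cold box (`tiltCubicW`).  Obligation F
of LINE-17 (`stub_gaussSideTerms`, STUB-PLAN-E §5) needs the same cubic chaos for ONE plaquette (the cubic Taylor term `β^{-1/2}P₃,p` of the
observables `obsF`, `obsG`).  This file threads an arbitrary finset `S` of plaquettes through E(1):

* `tiltCubicOn ρ H S β t = Σ_{q ∈ S} β·½Σ_{k<l}σₖσₗ·T_ρ(s_q,a_k,a_l)` (so `tiltCubicW = tiltCubicOn (plaquettesTouching Λ)`, `tiltCubicW_eq_tiltCubicOn`);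
* `legTensorOn H S`, `tiltCubicTensorOn ρ H S` — the edge / leg tensors of the sub-family;
* **`tiltCubicOn_eq_inv_sqrt_mul_cubicForm`**: `tiltCubicOn ρ H S β t = (√β)⁻¹·Σ_{abc} tiltCubicTensorOn ρ H S a b c·(t_a t_b t_c)` (from the landed
  per-plaquette identity `plaquette_cubic_eq_sum`);
* the three partial-trace conditions `sum_sum_tiltCubicTensorOn_mul_eq_zero₁₂/₁₃/₂₃` against any colour-block-diagonal kernel.

Everything proved; three definitions; standard axioms.  HONEST LABEL: helper toward the open registered stubs E/F of a critic-passed line on the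
R2ξ″ RECORD-rung crux 24003; no stub is proved by name, no crux, rung or summit is proved; the Yang–Mills mass gap is NOT proved by this file.
-/

set_option autoImplicit false

noncomputable section

open MeasureTheory Finset
open Literature.Probability.LatticeModels (Site)
open Literature.MathematicalPhysics.QuantumLattice
open Literature.MathematicalPhysics.QuantumFieldTheory
open Literature.MathematicalPhysics.QuantumFieldTheory.LatticeMaxwell
open Literature.MathematicalPhysics.QuantumFieldTheory.AxialGauge
open Summit.QuantumFields.YangMills.Theorems.WeakCouplingRates
open Summit.QuantumFields.YangMills.Theorems.FreeEnergyLogCoefficient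

namespace Summit.QuantumFields.YangMills.Theorems.ColdBoxAllGroups

variable {N : ℕ} {G : Type*} [Group G] (ρ : G →* Matrix (Fin N) (Fin N) ℂ) {H : ℕ}

/-! ## §1 The cubic term of a sub-family of plaquettes -/

variable (H) in
/-- **The cubic part of the tilt restricted to a finset `S` of plaquettes**: `Σ_{q ∈ S} β·½(T(s,a₁,a₂) − T(s,a₁,a₃) − T(s,a₁,a₄) − T(s,a₂,a₃) −
T(s,a₂,a₄) + T(s,a₃,a₄))`, legs and signs as in `tiltCubicW` (which is the case `S = plaquettesTouching Λ`). -/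
def tiltCubicOn (S : Finset (ZdPlaquette 4)) (β : ℝ) (t : TSpaceD H (dimE ρ)) : ℝ :=
  ∑ q ∈ S,
    β * ((chartCubic ρ (circV (extZero (unscaleTE H (dimE ρ) β t)) (q.1, q.2.1.1, q.2.1.2))
          (extZero (unscaleTE H (dimE ρ) β t) (q.1, q.2.1.1))
          (extZero (unscaleTE H (dimE ρ) β t) (q.1 + Pi.single q.2.1.1 1, q.2.1.2)) -
        chartCubic ρ (circV (extZero (unscaleTE H (dimE ρ) β t)) (q.1, q.2.1.1, q.2.1.2))
          (extZero (unscaleTE H (dimE ρ) β t) (q.1, q.2.1.1))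
          (extZero (unscaleTE H (dimE ρ) β t) (q.1 + Pi.single q.2.1.2 1, q.2.1.1)) -
        chartCubic ρ (circV (extZero (unscaleTE H (dimE ρ) β t)) (q.1, q.2.1.1, q.2.1.2))
          (extZero (unscaleTE H (dimE ρ) β t) (q.1, q.2.1.1)) (extZero (unscaleTE H (dimE ρ) β t) (q.1, q.2.1.2)) -
        chartCubic ρ (circV (extZero (unscaleTE H (dimE ρ) β t)) (q.1, q.2.1.1, q.2.1.2))
          (extZero (unscaleTE H (dimE ρ) β t) (q.1 + Pi.single q.2.1.1 1, q.2.1.2))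
          (extZero (unscaleTE H (dimE ρ) β t) (q.1 + Pi.single q.2.1.2 1, q.2.1.1)) -
        chartCubic ρ (circV (extZero (unscaleTE H (dimE ρ) β t)) (q.1, q.2.1.1, q.2.1.2))
          (extZero (unscaleTE H (dimE ρ) β t) (q.1 + Pi.single q.2.1.1 1, q.2.1.2))
          (extZero (unscaleTE H (dimE ρ) β t) (q.1, q.2.1.2)) +
        chartCubic ρ (circV (extZero (unscaleTE H (dimE ρ) β t)) (q.1, q.2.1.1, q.2.1.2))
          (extZero (unscaleTE H (dimE ρ) β t) (q.1 + Pi.single q.2.1.2 1, q.2.1.1))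
          (extZero (unscaleTE H (dimE ρ) β t) (q.1, q.2.1.2))) / 2)

/-- The cubic part of the tilt is the cubic term of the family of all plaquettes touching the cold box. -/
theorem tiltCubicW_eq_tiltCubicOn (β : ℝ) (t : TSpaceD H (dimE ρ)) :
    tiltCubicW ρ H β t = tiltCubicOn ρ H (plaquettesTouching (boxEdges 4 (2 * H + 1))) β t := rfl

variable (H) in
/-- The edge 3-tensor of a sub-family: `A^S_{xyz} = Σ_{q ∈ S} λ_q(x)·legPair q y z`. -/
def legTensorOn (S : Finset (ZdPlaquette 4)) (x y z : DirFree H) : ℝ :=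
  ∑ q ∈ S, coeff (fun e => e ∉ dirFreeEdges H) dirCorner (2 * H + 3) ((q.1, q.2.1.1, q.2.1.2) : Plaq 4) x *
    legPair (q.1, q.2.1.1, q.2.1.2) y z

/-- `legTensor` is the case of all touching plaquettes. -/
theorem legTensor_eq_legTensorOn (x y z : DirFree H) :
    legTensor H x y z = legTensorOn H (plaquettesTouching (boxEdges 4 (2 * H + 1))) x y z := rfl

variable (H) in
/-- The cubic tensor of a sub-family on the legs `Fin D × DirFree H`: `τ ⊗ A^S`. -/
def tiltCubicTensorOn (S : Finset (ZdPlaquette 4)) (a b c : Fin (dimE ρ) × DirFree H) : ℝ :=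
  chartCubic ρ (EuclideanSpace.single a.1 1) (EuclideanSpace.single b.1 1) (EuclideanSpace.single c.1 1) * legTensorOn H S a.2 b.2 c.2

/-! ## §2 Partial-trace conditions -/

section Trace

variable (S : Finset (ZdPlaquette 4))

/-- Slots 1,2: every term `B_{abc}·C_{ab}` vanishes against a colour-block-diagonal kernel. -/
theorem tiltCubicTensorOn_mul_eq_zero₁₂ {C : Fin (dimE ρ) × DirFree H → Fin (dimE ρ) × DirFree H → ℝ}
    (hC : ∀ a b, a.1 ≠ b.1 → C a b = 0) (a b c : Fin (dimE ρ) × DirFree H) : tiltCubicTensorOn ρ H S a b c * C a b = 0 := by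
  by_cases h : a.1 = b.1
  · rw [tiltCubicTensorOn, h, chartCubic_self₁₂]; ring
  · rw [hC a b h, mul_zero]

/-- Slots 1,3. -/
theorem tiltCubicTensorOn_mul_eq_zero₁₃ {C : Fin (dimE ρ) × DirFree H → Fin (dimE ρ) × DirFree H → ℝ}
    (hC : ∀ a b, a.1 ≠ b.1 → C a b = 0) (a b c : Fin (dimE ρ) × DirFree H) : tiltCubicTensorOn ρ H S a b c * C a c = 0 := by
  by_cases h : a.1 = c.1
  · rw [tiltCubicTensorOn, h, chartCubic_self₁₃]; ring
  · rw [hC a c h, mul_zero]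

/-- Slots 2,3. -/
theorem tiltCubicTensorOn_mul_eq_zero₂₃ {C : Fin (dimE ρ) × DirFree H → Fin (dimE ρ) × DirFree H → ℝ}
    (hC : ∀ a b, a.1 ≠ b.1 → C a b = 0) (a b c : Fin (dimE ρ) × DirFree H) : tiltCubicTensorOn ρ H S a b c * C b c = 0 := by
  by_cases h : b.1 = c.1
  · rw [tiltCubicTensorOn, h, chartCubic_self₂₃]; ring
  · rw [hC b c h, mul_zero]

/-- **Partial-trace condition (1,2)** (`hB12` of `CubicChaos.integral_cubicForm_sq_le`). -/
theorem sum_sum_tiltCubicTensorOn_mul_eq_zero₁₂ {C : Fin (dimE ρ) × DirFree H → Fin (dimE ρ) × DirFree H → ℝ}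
    (hC : ∀ a b, a.1 ≠ b.1 → C a b = 0) (c : Fin (dimE ρ) × DirFree H) :
    (∑ a, ∑ b, tiltCubicTensorOn ρ H S a b c * C a b) = 0 :=
  Finset.sum_eq_zero fun a _ => Finset.sum_eq_zero fun b _ => tiltCubicTensorOn_mul_eq_zero₁₂ ρ S hC a b c

/-- **Partial-trace condition (1,3)** (`hB13`). -/
theorem sum_sum_tiltCubicTensorOn_mul_eq_zero₁₃ {C : Fin (dimE ρ) × DirFree H → Fin (dimE ρ) × DirFree H → ℝ}
    (hC : ∀ a b, a.1 ≠ b.1 → C a b = 0) (b : Fin (dimE ρ) × DirFree H) :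
    (∑ a, ∑ c, tiltCubicTensorOn ρ H S a b c * C a c) = 0 :=
  Finset.sum_eq_zero fun a _ => Finset.sum_eq_zero fun c _ => tiltCubicTensorOn_mul_eq_zero₁₃ ρ S hC a b c

/-- **Partial-trace condition (2,3)** (`hB23`). -/
theorem sum_sum_tiltCubicTensorOn_mul_eq_zero₂₃ {C : Fin (dimE ρ) × DirFree H → Fin (dimE ρ) × DirFree H → ℝ}
    (hC : ∀ a b, a.1 ≠ b.1 → C a b = 0) (a : Fin (dimE ρ) × DirFree H) :
    (∑ b, ∑ c, tiltCubicTensorOn ρ H S a b c * C b c) = 0 :=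
  Finset.sum_eq_zero fun b _ => Finset.sum_eq_zero fun c _ => tiltCubicTensorOn_mul_eq_zero₂₃ ρ S hC a b c

end Trace

/-! ## §3 The cubic term of a sub-family as a cubic form in the coordinates -/

/-- **E(1) for a sub-family**: for `β > 0`, `tiltCubicOn ρ H S β t = (√β)⁻¹·Σ_{abc} tiltCubicTensorOn ρ H S a b c·(t_{a₁a₂} t_{b₁b₂} t_{c₁c₂})`. -/
theorem tiltCubicOn_eq_inv_sqrt_mul_cubicForm (S : Finset (ZdPlaquette 4)) {β : ℝ} (hβ : 0 < β) (t : TSpaceD H (dimE ρ)) :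
    tiltCubicOn ρ H S β t = (Real.sqrt β)⁻¹ * ∑ a : Fin (dimE ρ) × DirFree H, ∑ b : Fin (dimE ρ) × DirFree H,
      ∑ c : Fin (dimE ρ) × DirFree H, tiltCubicTensorOn ρ H S a b c * (t a.1 a.2 * t b.1 b.2 * t c.1 c.2) := by
  have hsq : Real.sqrt β ^ 2 = β := Real.sq_sqrt hβ.le
  have hc : β * (Real.sqrt β)⁻¹ ^ 3 = (Real.sqrt β)⁻¹ := by
    rw [inv_pow, show Real.sqrt β ^ 3 = β * Real.sqrt β by rw [pow_succ, hsq], mul_inv, ← mul_assoc,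
      mul_inv_cancel₀ hβ.ne', one_mul]
  rw [tiltCubicOn, Finset.sum_congr rfl fun q _ => plaquette_cubic_eq_sum ρ β t q, ← Finset.mul_sum, hc]
  congr 1
  simp only [tiltCubicTensorOn, legTensorOn, Finset.sum_mul, Finset.mul_sum]
  rw [Finset.sum_comm]
  refine Finset.sum_congr rfl fun a _ => ?_
  rw [Finset.sum_comm]
  refine Finset.sum_congr rfl fun b _ => ?_
  rw [Finset.sum_comm]

end Summit.QuantumFields.YangMills.Theorems.ColdBoxAllGroups

end
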